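import Literature.Analysis.FluidPDE.PerturbedNSFourierIteration
import HarnessLib

/-!
# Every polynomial decay of the Fourier-side solution of the perturbed Navier–Stokes system

Analysis/FluidPDE proof file, sequel of `PerturbedNSFourierIteration` in the chain
`PerturbedNSFourier*` (short-time smooth solutions of
`∂ₜv + (v·∇)v + (u·∇)v + (v·∇)u + ∇q = νΔv`, `div v = 0`, `v(0) = v₀` around a smooth
divergence-free background on `T^d`, `#d ≤ 3`; Majda–Bertozzi 2002, Thm. 3.4; Cheskidov–Luo
2022, §3.1 (3.2)). On the short interval of `PerturbedNSFourierPicard` the iterates `cₙ` lie in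
the ball of the base order FOUR; here they are shown to decay to **every** polynomial order,
uniformly in `n` and in time, hence so does the limit `c = picardLim` (`iter_hasDecay_all`,
`hasDecay_picardLim_all`). The interval is NOT shrunk: at order `K + 2` the symbol constant is
*affine* in the order-`(K+2)` constant of the field (`hasDecay_convSym_four`, the base-order
constants being fixed by the ball), so with the time weight `e^{λt}` and the heat gain
`(1 + ‖k‖)∫₀^τ e^{-νₖ(τ-s)} e^{λs} ds ≤ e^{λτ}E(ν)/√λ` (`ScalarFourier.heat_weight_gain`) the
weighted order-`(K+2)` constants `Yₙ` of the iterates obey `Yₙ₊₁ ≤ A₀ + Yₙ/2 + const` once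
`λ = λ_K` is large (`A₀` the order-`(K+2)` constant of the datum) — the time-weight device of
`ScalarFourierPicard` / `CorrectorFourierRegularity`, run along the iteration. Only the
existence of the solution uses these higher constants; the life span was fixed at order four.

## References

* A. J. Majda, A. L. Bertozzi, *Vorticity and Incompressible Flow*, CUP 2002, Thm. 3.4. [`MajdaBertozziCUP2002`]
* A. Cheskidov, X. Luo, arXiv:2009.06596, §3.1 (3.2). [`CheskidovLuo2022`]
* P. G. Lemarié-Rieusset, *The Navier–Stokes problem in the 21st century*, CRC 2016, §8.5.
-/

noncomputable section

open MeasureTheory Real Set Filter Topology UnitAddTorus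

namespace Literature.Analysis.FluidPDE

namespace PerturbedNSFourier

open ScalarFourier
open CorrectorFourier (leraySym projSym hasDecay_projSym_of_convSym)
open FourierNS (HasDecay clamp)
open Literature.Analysis.FunctionSpaces.Torus (freqNormSq)

variable {d : Type*} [Fintype d] [DecidableEq d]
variable {ν θ : ℝ} {U : d → ℝ → (d → ℤ) → ℂ} {a : d → (d → ℤ) → ℂ} {Z ρ A : ℝ}

set_option maxHeartbeats 400000 in
/-- **Higher orders along the iteration.** Under the threshold hypotheses (all iterates in the
order-four ball of radius `ρ`), for every `K` the iterates decay to order `K + 2` with a common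
constant (the weighted bootstrap described in the module docstring, by induction on `n` — the
iteration starts at `c₀ = 0`; the datum term contributes its own order-`(K+2)` constant, the
heat factor being at most one; adapted from `CorrectorFourier.DataHyp.iter_hasDecay_succ`). [folklore] -/
theorem BallHyp.iter_hasDecay_succ (h : BallHyp ν θ U a Z ρ A) (K : ℕ) :
    ∃ C : ℝ, 0 ≤ C ∧ ∀ n l t, HasDecay (K + 2) C (picardIter ν θ U a n l t) := by
  obtain ⟨-, hball, -, -, -⟩ := h.iter_tendsto
  have hρ := h.hρ
  have hA := h.hA
  have hZ0 : 0 ≤ Z := weight_four_mass_nonneg h.hZ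
  -- data constants at order `K + 2`
  obtain ⟨A', hA'⟩ := h.decayU (K + 2)
  obtain ⟨A₀', hA₀'⟩ := h.decayA (K + 2)
  set A₂ : ℝ := max A' 0 with hA₂
  set A₀ : ℝ := max A₀' 0 with hA₀
  have hA₂0 : 0 ≤ A₂ := le_max_right _ _
  have hA₀0 : 0 ≤ A₀ := le_max_right _ _
  have hU₂ : ∀ j t, HasDecay (K + 2) A₂ (U j t) := fun j t => (hA' j t).mono (le_max_left _ _)
  have ha₂ : ∀ l, HasDecay (K + 2) A₀ (a l) := fun l => (hA₀' l).mono (le_max_left _ _)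
  have hR : ∀ i j : d, HasDecay (K + 1 + 1) 0 ((0 : d → d → (d → ℤ) → ℂ) i j) := fun i j m => by
    simp only [Pi.zero_apply, norm_zero, zero_mul, le_refl]
  -- the affine dependence `α X + β` of the symbol constant on the order-`(K+2)` constant `X`
  set α : ℝ := Fintype.card d * (2 ^ (K + 1) * Z * (2 * π * (2 * ρ + 2 * A))) with hα
  set β : ℝ := Fintype.card d * (2 ^ (K + 1) * Z * (2 * π * (2 * ρ * A₂))) with hβ
  have hα0 : 0 ≤ α := by positivity
  have hβ0 : 0 ≤ β := by positivity
  set E : ℝ := 1 + 1 / (2 * Real.sqrt (4 * π ^ 2 * ν)) with hE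
  have hE0 : 0 ≤ E := by positivity
  -- the weight `λ` with `2#d E α / √λ ≤ 1/2`
  set L : ℝ := 2 * Fintype.card d * E * α with hL
  have hL0 : 0 ≤ L := by positivity
  set lam : ℝ := (2 * L) ^ 2 + 1 with hlam
  have hlam1 : 1 ≤ lam := by rw [hlam]; exact le_add_of_nonneg_left (sq_nonneg _)
  have hlam0 : 0 ≤ lam := by linarith
  have hsq : 2 * L ≤ Real.sqrt lam := by
    calc 2 * L = Real.sqrt ((2 * L) ^ 2) := (Real.sqrt_sq (by positivity)).symm
      _ ≤ Real.sqrt lam := Real.sqrt_le_sqrt (by rw [hlam]; linarith)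
  have hspos : 0 < Real.sqrt lam := Real.sqrt_pos.2 (by linarith)
  set q : ℝ := 2 * Fintype.card d * E / Real.sqrt lam with hq
  have hq0 : 0 ≤ q := by positivity
  have hqα : q * α ≤ 1 / 2 := by
    rw [hq, div_mul_eq_mul_div, div_le_iff₀ hspos]
    have : 2 * Fintype.card d * E * α = L := by rw [hL]
    rw [this]
    linarith
  set Y : ℝ := 2 * (A₀ + q * β) with hY
  have hY0 : 0 ≤ Y := by positivity
  have hstep : A₀ + q * (α * Y + β) ≤ Y := by
    have e1 : q * (α * Y + β) = (q * α) * Y + q * β := by ring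
    have h1 : (q * α) * Y ≤ 1 / 2 * Y := mul_le_mul_of_nonneg_right hqα hY0
    rw [e1]
    have e2 : Y = 2 * (A₀ + q * β) := hY
    linarith
  -- inner induction on `n`: the weighted order-`(K+2)` bound
  have hiter : ∀ n l t, HasDecay (K + 2) (Y * Real.exp (lam * clamp θ t)) (picardIter ν θ U a n l t) := by
    intro n
    induction n with
    | zero =>
      intro l t m
      simp only [picardIter_zero, norm_zero]
      positivity
    | succ n ih =>
      intro l t k
      have hτ := FourierNS.clamp_mem_Icc h.hθ.le t
      set τ := clamp θ t with hτdef
      -- the integrand bound `‖(P G)(cₙ(s))‖ ≤ 2#d (αY + β) e^{λ s} (1+‖k‖)^{-(K+1)}` on `[0, τ]`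
      have hN : ∀ s ∈ Icc 0 τ, ‖projSym (fun j => U j s) 0 (fun j => picardIter ν θ U a n j s) l k‖ ≤
          2 * Fintype.card d * (α * Y + β) * ((1 + ‖k‖) ^ (K + 1))⁻¹ * Real.exp (lam * s) := by
        intro s hs
        have hsθ : s ∈ Icc 0 θ := ⟨hs.1, hs.2.trans hτ.2⟩
        have hXs : 0 ≤ Y * Real.exp (lam * clamp θ s) := by positivity
        have hconv := fun m => hasDecay_convSym_four (K := K + 1) (RH := (0 : d → d → (d → ℤ) → ℂ))
          h.hZ hA₂0 hXs (fun j => h.hU4 j s) (fun j => hU₂ j s) (fun j => hball n j s) (fun j => ih j s)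
          hR m
        have hproj := hasDecay_projSym_of_convSym hconv l k
        refine hproj.trans ?_
        rw [FourierNS.clamp_of_mem hsθ]
        have hexp1 : 1 ≤ Real.exp (lam * s) := Real.one_le_exp (mul_nonneg hlam0 hs.1)
        have hw : 0 ≤ ((1 + ‖k‖) ^ (K + 1))⁻¹ := by positivity
        -- the constant is `α (Y e^{λs}) + β ≤ (αY + β) e^{λs}`
        have hconst : Fintype.card d * (2 ^ (K + 1) * Z *
            (Y * Real.exp (lam * s) * (2 * π * ρ) + ρ * (2 * π * (Y * Real.exp (lam * s))))) +
            Fintype.card d * (2 ^ (K + 1) * Z * (A₂ * (2 * π * ρ) + A * (2 * π * (Y * Real.exp (lam * s))))) +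
            Fintype.card d * (2 ^ (K + 1) * Z *
              (Y * Real.exp (lam * s) * (2 * π * A) + ρ * (2 * π * A₂))) +
            Fintype.card d * (2 * π * 0) =
            α * (Y * Real.exp (lam * s)) + β := by
          rw [hα, hβ]; ring
        rw [hconst]
        have h2 : α * (Y * Real.exp (lam * s)) + β ≤ (α * Y + β) * Real.exp (lam * s) := by
          have e1 : (α * Y + β) * Real.exp (lam * s) =
              α * (Y * Real.exp (lam * s)) + β * Real.exp (lam * s) := by ring
          have h3 : β * 1 ≤ β * Real.exp (lam * s) := mul_le_mul_of_nonneg_left hexp1 hβ0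
          rw [e1]
          linarith
        calc 2 * Fintype.card d * (α * (Y * Real.exp (lam * s)) + β) * ((1 + ‖k‖) ^ (K + 1))⁻¹
            ≤ 2 * Fintype.card d * ((α * Y + β) * Real.exp (lam * s)) * ((1 + ‖k‖) ^ (K + 1))⁻¹ := by
              gcongr
          _ = _ := by ring
      -- Duhamel bound and heat gain
      have hM := norm_duhamel_le ν hτ.1 hN k
      have hgain := heat_weight_gain (d := d) h.hν hlam1 k hτ.1
      have hw : (0 : ℝ) < 1 + ‖k‖ := by positivity
      have hpow : ((1 + ‖k‖) ^ (K + 2))⁻¹ = ((1 + ‖k‖) ^ (K + 1))⁻¹ * (1 + ‖k‖)⁻¹ := by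
        rw [pow_succ, mul_inv]
      have hMnn : 0 ≤ 2 * Fintype.card d * (α * Y + β) * ((1 + ‖k‖) ^ (K + 1))⁻¹ := by positivity
      have key : (1 + ‖k‖) * ‖∫ s in (0 : ℝ)..τ, (heatFactor ν k (τ - s) : ℂ) *
          projSym (fun j => U j s) 0 (fun j => picardIter ν θ U a n j s) l k‖ ≤
          2 * Fintype.card d * (α * Y + β) * ((1 + ‖k‖) ^ (K + 1))⁻¹ *
            (Real.exp (lam * τ) * (E / Real.sqrt lam)) := by
        calc _ ≤ (1 + ‖k‖) * (2 * Fintype.card d * (α * Y + β) * ((1 + ‖k‖) ^ (K + 1))⁻¹ *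
              ∫ s in (0 : ℝ)..τ, Real.exp (-(heatRate ν k) * (τ - s)) * Real.exp (lam * s)) :=
              mul_le_mul_of_nonneg_left hM (by positivity)
          _ = 2 * Fintype.card d * (α * Y + β) * ((1 + ‖k‖) ^ (K + 1))⁻¹ *
              ((1 + ‖k‖) * ∫ s in (0 : ℝ)..τ, Real.exp (-(heatRate ν k) * (τ - s)) * Real.exp (lam * s)) := by
              ring
          _ ≤ 2 * Fintype.card d * (α * Y + β) * ((1 + ‖k‖) ^ (K + 1))⁻¹ *
              (Real.exp (lam * τ) * (E / Real.sqrt lam)) := by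
              refine mul_le_mul_of_nonneg_left ?_ hMnn
              simpa [hE] using hgain
      -- the Duhamel term at order `K + 2`
      have hduh : ‖∫ s in (0 : ℝ)..τ, (heatFactor ν k (τ - s) : ℂ) *
          projSym (fun j => U j s) 0 (fun j => picardIter ν θ U a n j s) l k‖ ≤
          q * (α * Y + β) * Real.exp (lam * τ) * ((1 + ‖k‖) ^ (K + 2))⁻¹ := by
        rw [hpow, ← mul_assoc, le_mul_inv_iff₀ hw, mul_comm]
        refine key.trans (le_of_eq ?_)
        rw [hq]
        ring
      -- the datum term at order `K + 2`
      have hheat : ‖(heatFactor ν k τ : ℂ) * a l k‖ ≤ A₀ * Real.exp (lam * τ) * ((1 + ‖k‖) ^ (K + 2))⁻¹ := by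
        rw [norm_mul, norm_heatFactor]
        have hexpτ : 1 ≤ Real.exp (lam * τ) := Real.one_le_exp (mul_nonneg hlam0 hτ.1)
        have hwK : 0 ≤ ((1 + ‖k‖) ^ (K + 2))⁻¹ := by positivity
        calc heatFactor ν k τ * ‖a l k‖ ≤ 1 * ‖a l k‖ :=
              mul_le_mul_of_nonneg_right (heatFactor_le_one h.hν.le k hτ.1) (norm_nonneg _)
          _ ≤ A₀ * ((1 + ‖k‖) ^ (K + 2))⁻¹ := by rw [one_mul]; exact ha₂ l k
          _ = A₀ * 1 * ((1 + ‖k‖) ^ (K + 2))⁻¹ := by ring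
          _ ≤ A₀ * Real.exp (lam * τ) * ((1 + ‖k‖) ^ (K + 2))⁻¹ := by gcongr
      rw [picardIter_succ, picardMap, ← hτdef]
      have hexp0 : 0 ≤ Real.exp (lam * τ) := (Real.exp_pos _).le
      have hwK : 0 ≤ ((1 + ‖k‖) ^ (K + 2))⁻¹ := by positivity
      calc ‖(heatFactor ν k τ : ℂ) * a l k - ∫ s in (0 : ℝ)..τ, (heatFactor ν k (τ - s) : ℂ) *
            projSym (fun j => U j s) 0 (fun j => picardIter ν θ U a n j s) l k‖
          ≤ ‖(heatFactor ν k τ : ℂ) * a l k‖ + ‖∫ s in (0 : ℝ)..τ, (heatFactor ν k (τ - s) : ℂ) *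
            projSym (fun j => U j s) 0 (fun j => picardIter ν θ U a n j s) l k‖ := norm_sub_le _ _
        _ ≤ A₀ * Real.exp (lam * τ) * ((1 + ‖k‖) ^ (K + 2))⁻¹ +
            q * (α * Y + β) * Real.exp (lam * τ) * ((1 + ‖k‖) ^ (K + 2))⁻¹ := add_le_add hheat hduh
        _ = (A₀ + q * (α * Y + β)) * Real.exp (lam * τ) * ((1 + ‖k‖) ^ (K + 2))⁻¹ := by ring
        _ ≤ Y * Real.exp (lam * τ) * ((1 + ‖k‖) ^ (K + 2))⁻¹ := by gcongr
  refine ⟨Y * Real.exp (lam * θ), by positivity, fun n l t => (hiter n l t).mono ?_⟩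
  exact mul_le_mul_of_nonneg_left (exp_clamp_le (T := θ) hlam0 h.hθ.le t) hY0

/-- **Every polynomial decay along the iteration, uniformly in `n` and `t`.** [folklore] -/
theorem BallHyp.iter_hasDecay_all (h : BallHyp ν θ U a Z ρ A) (K : ℕ) :
    ∃ C : ℝ, 0 ≤ C ∧ ∀ n l t, HasDecay K C (picardIter ν θ U a n l t) := by
  obtain ⟨C, hC0, hC⟩ := h.iter_hasDecay_succ K
  exact ⟨C, hC0, fun n l t => (hC n l t).of_le (by omega)⟩

/-- **Every polynomial decay of the Picard limit on a short interval**, uniformly in time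
(limits of the uniform bounds along the iteration). [folklore] -/
theorem BallHyp.hasDecay_picardLim_all (h : BallHyp ν θ U a Z ρ A) (K : ℕ) :
    ∃ C : ℝ, 0 ≤ C ∧ ∀ l t, HasDecay K C (picardLim ν θ U a l t) := by
  obtain ⟨-, -, htend, -, -⟩ := h.iter_tendsto
  obtain ⟨C, hC0, hC⟩ := h.iter_hasDecay_all K
  refine ⟨C, hC0, fun l t m => ?_⟩
  exact le_of_tendsto ((continuous_norm.tendsto _).comp (htend l t m))
    (Eventually.of_forall fun n => hC n l t m)

end PerturbedNSFourier

end Literature.Analysis.FluidPDE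

end
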